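import Literature.Analysis.InverseSpectral.KreinStringWeylLimit
import HarnessLib

/-!
# Kreĭn strings: prepending a massless segment

If `S' ` is obtained from the string `S[m, L]` by prepending a massless segment of length `a > 0`
(`L' = L + a`, `dm' = ` push-forward of `dm` under `x ↦ x + a`), then the fundamental system of
`S' ` is `φ'(x) = φ(x - a)`, `ψ'(x) = a φ(x - a) + ψ(x - a)` for `x ≥ a` (and `1`, `x` on `[0, a]`),
so that the principal Titchmarsh–Weyl functions satisfy

  `q_{S'}(z) = a + q_S(z)`

(`principalWeylFunction_shift`): the other step of Stieltjes' continued fraction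
`q = l₀ + 1/(-m₁ z + 1/(l₁ + …))` (Kac–Kreĭn 1974 §2; together with
`principalWeylFunction_add_dirac` this computes `q_S` for every Stieltjes string).

## References

KacKrein1974 (§§1–2), DymMcKean1976 (§5.8).
-/

open MeasureTheory Filter Set Topology
open scoped ENNReal

noncomputable section

namespace Literature.Analysis.InverseSpectral

namespace KreinString

section Shift

variable {S S' : KreinString} {a : ℝ}

/-- Membership in the parameter interval of the longer string, for points beyond `a`. [folklore] -/
lemma mem_dom_shift_iff (hL : S'.length = S.length + ENNReal.ofReal a) (ha : 0 ≤ a) {x : ℝ}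
    (hx : a ≤ x) : x ∈ S'.dom ↔ x - a ∈ S.dom := by
  rw [KreinString.mem_dom, KreinString.mem_dom, hL]
  have hsplit : ENNReal.ofReal x = ENNReal.ofReal (x - a) + ENNReal.ofReal a := by
    rw [← ENNReal.ofReal_add (by linarith) ha, sub_add_cancel]
  rw [hsplit, ENNReal.add_lt_add_iff_right ENNReal.ofReal_ne_top]
  constructor
  · rintro ⟨-, h⟩
    exact ⟨by linarith, h⟩
  · rintro ⟨-, h⟩
    exact ⟨by linarith, h⟩

/-- Points of `[0, a]` belong to the longer string. [folklore] -/
lemma mem_dom_of_le (hL : S'.length = S.length + ENNReal.ofReal a) {x : ℝ} (hx0 : 0 ≤ x)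
    (hxa : x ≤ a) : x ∈ S'.dom := by
  rw [KreinString.mem_dom, hL]
  refine ⟨hx0, lt_of_le_of_lt (ENNReal.ofReal_le_ofReal hxa) ?_⟩
  calc ENNReal.ofReal a = 0 + ENNReal.ofReal a := (zero_add _).symm
    _ < S.length + ENNReal.ofReal a := ENNReal.add_lt_add_right ENNReal.ofReal_ne_top S.length_pos

/-- **Set integrals against the shifted mass**: for `g` and `x ≥ a`,
`∫_{[0,x]} g d(dm ∘ (· - a)) = ∫_{[0,x-a]} g(u + a) dm(u)`; for `x < a` the integral vanishes.
[folklore] -/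
lemma setIntegral_shift (hm : S'.massMeasure = S.massMeasure.map (fun u => u + a)) (ha : 0 ≤ a)
    (g : ℝ → ℂ) (x : ℝ) :
    ∫ s in Icc 0 x, g s ∂S'.massMeasure = ∫ u in Icc 0 (x - a), g (u + a) ∂S.massMeasure := by
  rw [hm, (measurableEmbedding_addRight a).setIntegral_map, Set.preimage_add_const_Icc, zero_sub]
  -- `[-a, x-a]` and `[0, x-a]` differ by a `dm`-null set
  refine setIntegral_congr_set ?_
  refine (ae_eq_set).2 ⟨?_, ?_⟩
  · refine measure_mono_null (fun u hu => ?_) S.massMeasure_Iio_zero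
    simp only [Set.mem_sdiff, mem_Icc, not_and, not_le] at hu
    by_contra h
    exact absurd (hu.2 (not_lt.1 h)) (not_lt.2 hu.1.2)
  · refine measure_mono_null (fun u hu => ?_) (measure_empty (μ := S.massMeasure))
    simp only [Set.mem_sdiff, mem_Icc, not_and, not_le] at hu
    exact absurd (hu.2 (by linarith [hu.1.1])) (not_lt.2 hu.1.2)

/-- Continuity of the glued candidate solutions of the longer string. [folklore] -/
lemma continuousOn_shift_aux (hL : S'.length = S.length + ENNReal.ofReal a) (ha : 0 < a)
    {f : ℝ → ℂ} (hf : ContinuousOn f S.dom) {c : ℝ → ℂ} (hc : Continuous c)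
    (hca : c a = f 0) :
    ContinuousOn (fun x => if x < a then c x else f (x - a)) S'.dom := by
  refine ContinuousOn.if ?_ ?_ ?_
  · intro x hx
    have hfr : frontier {x : ℝ | x < a} = {a} := frontier_Iio
    rw [hfr] at hx
    obtain ⟨-, rfl⟩ := hx
    simp [hca]
  · exact hc.continuousOn
  · have hcl : closure {x : ℝ | ¬x < a} = Ici a := by
      have : {x : ℝ | ¬x < a} = Ici a := by ext x; simp [not_lt]
      rw [this, isClosed_Ici.closure_eq]
    rw [hcl]
    refine hf.comp (continuous_sub_right a).continuousOn (fun x hx => ?_)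
    exact (mem_dom_shift_iff hL ha.le hx.2).1 hx.1

/-- **Prepending a massless segment, effect on `φ`**: the glued function `1` on `[0,a]`,
`φ(x - a)` beyond, solves the new equation with data `(1, 0)`. [cite: KacKrein1974, §1] -/
theorem isSolution_shift_phi (hL : S'.length = S.length + ENNReal.ofReal a)
    (hm : S'.massMeasure = S.massMeasure.map (fun u => u + a)) (ha : 0 < a) (z : ℂ) :
    S'.IsSolution z 1 0 (fun x => if x < a then (1 : ℂ) else S.phi z (x - a)) := by
  refine ⟨continuousOn_shift_aux hL ha (S.isSolution_phi z).1 continuous_const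
    (by rw [S.phi_apply_zero]), fun x hx => ?_⟩
  dsimp only
  rw [setIntegral_shift hm ha.le]
  rcases lt_or_ge x a with hxa | hxa
  · -- on the massless segment
    rw [if_pos hxa, Icc_eq_empty (by linarith : ¬(0 : ℝ) ≤ x - a), Measure.restrict_empty,
      integral_zero_measure]
    ring
  · rw [if_neg (not_lt.2 hxa)]
    have hxd : x - a ∈ S.dom := (mem_dom_shift_iff hL ha.le hxa).1 hx
    have h := (S.isSolution_phi z).2 (x - a) hxd
    rw [h]
    congr 1
    · ring
    · congr 1
      refine setIntegral_congr_fun measurableSet_Icc (fun u hu => ?_)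
      rw [if_neg (by linarith [hu.1])]
      congr 1
      · push_cast; ring
      · rw [add_sub_cancel_right]

/-- **Prepending a massless segment, effect on `ψ`**: the glued function `x` on `[0,a]`,
`a φ(x-a) + ψ(x-a)` beyond, solves the new equation with data `(0, 1)`. [cite: KacKrein1974, §1] -/
theorem isSolution_shift_psi (hL : S'.length = S.length + ENNReal.ofReal a)
    (hm : S'.massMeasure = S.massMeasure.map (fun u => u + a)) (ha : 0 < a) (z : ℂ) :
    S'.IsSolution z 0 1
      (fun x => if x < a then (x : ℂ) else (a : ℂ) * S.phi z (x - a) + S.psi z (x - a)) := by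
  refine ⟨continuousOn_shift_aux hL ha (f := fun x => (a : ℂ) * S.phi z x + S.psi z x)
    (by exact (continuousOn_const.mul (S.isSolution_phi z).1).add (S.isSolution_psi z).1)
    Complex.continuous_ofReal (by simp only [S.phi_apply_zero, S.psi_apply_zero]; ring),
    fun x hx => ?_⟩
  dsimp only
  rw [setIntegral_shift hm ha.le]
  rcases lt_or_ge x a with hxa | hxa
  · rw [if_pos hxa, Icc_eq_empty (by linarith : ¬(0 : ℝ) ≤ x - a), Measure.restrict_empty,
      integral_zero_measure]
    ring
  · rw [if_neg (not_lt.2 hxa)]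
    have hxd : x - a ∈ S.dom := (mem_dom_shift_iff hL ha.le hxa).1 hx
    have hφ := (S.isSolution_phi z).2 (x - a) hxd
    have hψ := (S.isSolution_psi z).2 (x - a) hxd
    -- the integrand on `[0, x-a]`
    have hk : ContinuousOn (fun u : ℝ => ((x - a - u : ℝ) : ℂ)) (Icc 0 (x - a)) :=
      Complex.continuous_ofReal.comp_continuousOn (continuousOn_const.sub continuousOn_id)
    have hφc : ContinuousOn (S.phi z) (Icc 0 (x - a)) :=
      (S.isSolution_phi z).1.mono (S.Icc_subset_dom hxd)
    have hψc : ContinuousOn (S.psi z) (Icc 0 (x - a)) :=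
      (S.isSolution_psi z).1.mono (S.Icc_subset_dom hxd)
    have heq : ∫ u in Icc 0 (x - a), ((x - (u + a) : ℝ) : ℂ) *
        (if u + a < a then ((u + a : ℝ) : ℂ)
          else (a : ℂ) * S.phi z (u + a - a) + S.psi z (u + a - a))
        ∂S.massMeasure =
        (a : ℂ) * (∫ u in Icc 0 (x - a), ((x - a - u : ℝ) : ℂ) * S.phi z u ∂S.massMeasure) +
          ∫ u in Icc 0 (x - a), ((x - a - u : ℝ) : ℂ) * S.psi z u ∂S.massMeasure := by
      rw [← integral_const_mul, ← integral_add
        (f := fun u => (a : ℂ) * (((x - a - u : ℝ) : ℂ) * S.phi z u))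
        (g := fun u => ((x - a - u : ℝ) : ℂ) * S.psi z u)
        (by exact (S.integrableOn_Icc_of_continuousOn hxd (hk.mul hφc)).const_mul _)
        (by exact S.integrableOn_Icc_of_continuousOn hxd (hk.mul hψc))]
      refine setIntegral_congr_fun measurableSet_Icc (fun u hu => ?_)
      rw [if_neg (by linarith [hu.1]), add_sub_cancel_right]
      push_cast
      ring
    rw [heq]
    push_cast at hφ hψ ⊢
    linear_combination (a : ℂ) * hφ + hψ
/-- The longer string is not the free half-line if `S` is not. [folklore] -/
lemma not_isTrivial_shift (hL : S'.length = S.length + ENNReal.ofReal a)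
    (hm : S'.massMeasure = S.massMeasure.map (fun u => u + a)) (hS : ¬ S.IsTrivial) :
    ¬ S'.IsTrivial := by
  rintro ⟨hL', hm'⟩
  apply hS
  constructor
  · rw [hL] at hL'
    exact (ENNReal.add_eq_top.1 hL').resolve_right ENNReal.ofReal_ne_top
  · rw [hm] at hm'
    have h := congrArg (fun ν : Measure ℝ => ν univ) hm'
    simp only [Measure.map_apply (measurable_add_const a) MeasurableSet.univ, preimage_univ,
      Measure.coe_zero, Pi.zero_apply] at h
    exact Measure.measure_univ_eq_zero.1 h

/-- The shift `x ↦ x - a` maps the end filter of the longer string to that of `S`. [folklore] -/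
lemma tendsto_sub_toEnd (hL : S'.length = S.length + ENNReal.ofReal a) (ha : 0 < a) :
    Tendsto (fun x => x - a) S'.toEnd S.toEnd := by
  unfold toEnd
  by_cases hSL : S.length = ⊤
  · have hL' : S'.length = ⊤ := by rw [hL, hSL, top_add]
    rw [if_pos hL', if_pos hSL]
    simpa [sub_eq_add_neg] using tendsto_atTop_add_const_right atTop (-a) tendsto_id
  · have hL' : S'.length ≠ ⊤ := by
      rw [hL]; exact ENNReal.add_ne_top.2 ⟨hSL, ENNReal.ofReal_ne_top⟩
    rw [if_neg hL', if_neg hSL]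
    have hℓ : S'.length.toReal = S.length.toReal + a := by
      rw [hL, ENNReal.toReal_add hSL ENNReal.ofReal_ne_top, ENNReal.toReal_ofReal ha.le]
    rw [hℓ]
    refine tendsto_nhdsWithin_of_tendsto_nhds_of_eventually_within _ ?_ ?_
    · have h := (continuous_sub_right a).tendsto (S.length.toReal + a)
      rw [add_sub_cancel_right] at h
      exact h.mono_left nhdsWithin_le_nhds
    · filter_upwards [self_mem_nhdsWithin] with x hx
      simp only [mem_Iio] at hx ⊢
      linarith

/-- **Prepending a massless segment of length `a`**: `q_{S'}(z) = a + q_S(z)` for `z ∉ [0, ∞)`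
(`S` not the free half-line), the `l`-step of Stieltjes' continued fraction.
[cite: KacKrein1974, §2] -/
theorem principalWeylFunction_shift (hL : S'.length = S.length + ENNReal.ofReal a)
    (hm : S'.massMeasure = S.massMeasure.map (fun u => u + a)) (ha : 0 < a) (hS : ¬ S.IsTrivial)
    {z : ℂ} (hz : z ∈ offNonnegAxis) :
    S'.principalWeylFunction z = a + S.principalWeylFunction z := by
  haveI := S'.toEnd_neBot
  have hq := S.tendsto_principalWeylFunction hS hz
  have hφ' : EqOn (S'.phi z) (fun x => if x < a then (1 : ℂ) else S.phi z (x - a)) S'.dom :=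
    (S'.isSolution_phi z).eqOn (isSolution_shift_phi hL hm ha z)
  have hψ' : EqOn (S'.psi z)
      (fun x => if x < a then (x : ℂ) else (a : ℂ) * S.phi z (x - a) + S.psi z (x - a)) S'.dom :=
    (S'.isSolution_psi z).eqOn (isSolution_shift_psi hL hm ha z)
  have hev : ∀ᶠ x in S'.toEnd,
      (a : ℂ) + S.psi z (x - a) / S.phi z (x - a) = S'.psi z x / S'.phi z x := by
    filter_upwards [S'.Ici_inter_dom_mem_toEnd (mem_dom_of_le hL ha.le le_rfl)] with x hx
    have hxd : x - a ∈ S.dom := (mem_dom_shift_iff hL ha.le hx.2).1 hx.1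
    have hφ0 : S.phi z (x - a) ≠ 0 := S.phi_ne_zero_of_mem_offNonnegAxis hz hxd
    rw [hψ' hx.1, hφ' hx.1]
    dsimp only
    rw [if_neg (not_lt.2 hx.2), if_neg (not_lt.2 hx.2), add_div, mul_div_cancel_right₀ _ hφ0]
  have hlim : Tendsto (fun x => S'.psi z x / S'.phi z x) S'.toEnd
      (𝓝 ((a : ℂ) + S.principalWeylFunction z)) :=
    (tendsto_const_nhds.add (hq.comp (tendsto_sub_toEnd hL ha))).congr' hev
  exact hlim.limUnder_eq

end Shift

end KreinString

end Literature.Analysis.InverseSpectral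

end
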